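import Literature.MathematicalPhysics.QuantumFieldTheory.Balaban1983to89.B9HpDGWFromPinsSN
import Literature.MathematicalPhysics.QuantumFieldTheory.Balaban1983to89.B9Eq340ProbeReadOffKA
import Literature.MathematicalPhysics.QuantumFieldTheory.Balaban1983to89.B9SmoothHolderClassPI

/-!
# `Balaban1983to89.B9H44GFromPinsSN` — T. Bałaban, *Propagators for lattice gauge theories in a background field*, Commun. Math. Phys. **99** (1985) 389–434
# [Balaban1985BackgroundPropagators], (3.44) p. 398 «|(∇_UG′(U)∇\*_Uλ)(x)| ≦ B′₀(ε)e^{−δ₀d(y,y′)}(‖λ‖^{ξ′}_ε + |λ|)» and (3.45) p. 398 «‖ζ∇_UG′(U)∇\*_Uλ‖_β ≦ B′₀(ε,β)(Lʲη)^{−β}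
# (‖ζ‖^ξ_β + |ζ|)e^{−δ₀d(y,y′)}(‖λ‖^{ξ′}_{β+ε} + |λ|)» AT THE N06 CERTIFICATE's TRANSPORTED BOND CLASS `bHZKP (taxiB U)`: the displayed rows-20–21 binders `h44G` and `hp45W`
# ASSEMBLED from the rows-18 data and Corollary 3.6's local (3.44)∕(3.45) legs at the print-exact transported site class

[4] = T. Bałaban, *Propagators and renormalization transformations for lattice gauge theories. II*, Commun. Math. Phys. **96** (1984) 223–250 [`Balaban1984PropagatorsII`].
statement-level skeleton of published theorems with citation tags; proofs where landed; nothing here is a claim about the Yang–Mills mass gap.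

THE PRINT.  Thm 3.7 p. 409 + «Theorem 3.7 implies (3.42)–(3.47)» p. 410; Cor. 3.6 p. 408 (the local operators satisfy (3.42)–(3.47)); Thm 3.1 (3.44)–(3.45) p. 398 with «ξ′ = L^{j′}η»;
(3.40) p. 397; (3.35) p. 396; (3.8) p. 392; [4] Lemma 2.1 (2.60)–(2.61) p. 234, (2.51)–(2.56) pp. 232–233.

WHY THIS FILE (cell `pub-ymgap`, node N06 [B9], seat `pub-ymgap-dag-n06-c` g20; the G′ Hölder layer of rows 20–21, dag-n06-d `DISPLAY-LEDGER-UF.md` §2∕§5 binders `h44G`, `hp45W` —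
the last two of the four; `hpDGW`, `h43Gp` = `B9HpDGWFromPinsSN`, `B9H43GpFromPinsSN`; road memo `pub-ymgap-dag-n06-c/HPDGW-ROAD.md`; this seat's LOCATED-20).  Per member and
configuration: this lineage's per-direction-pair engine `B9RWSums344InputPairDir.inputPair3445_of_local37_dir` (Thm 3.7's random-walk sum: (3.88) `G′ = G′₀ + G′R′` read between
`∇_{U,ν}` and `∇\*_{U,μ}`, Cor. 3.6's local input legs, the (3.42)∕(3.43) components of `∇_νG′`, the factors `R′∇\*_μ`) RUN AT THE PRINT-EXACT TRANSPORTED SITE CLASS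
`bHZPIfam (taxiS U)` (`B9SmoothHolderClassPI`: `loc = |λ| + ‖λ‖^{ξ′}_s`); the direction slice `bHZKPI (taxiB U) s → bHZPI (taxiS U) s` (`hasMaj_dirSliceK_bHZKPI_bHZPI`, B1 re-weighted)
composed by [4] (2.52)–(2.56) (`B11SectG.hasMaj_comp_exp`, Lemma 2.1's row sum at `αδ₀`); the bond read-off `B9Eq340DirSumReadOff.hasMaj_bond_of_dirSumFamily` (def-Y's
`∇_U ∘ G′ ∘ ∇\*_U = (c_fη)²Σ_μ` of the directional words on the slices); the source length returned to the target by (2.60) (`hasMaj_bHZKP_of_bHZKPI`): `h44G`.  For `hp45W`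
the engine's (3.45) member at `(ε, β) = (sch β′ − β′, β′)` through the same slice, the near-probe transporter change `parSymY → parSY` of `B9Eq340ProbeTransferSNY` (print's (3.35))
and the bond-probe read-off `B9Eq340ProbeReadOffKA.hasMaj_probesKA_of_dirSumFamily`.
* ★★★ `h44G_hp45W_of_thm37PrintedSN` — hypotheses as in `hpDGW_of_thm37PrintedSN` (rows-18 letters, pins, static data, `hop`, the leaf `t37 ∕ hconv`) PLUS the direction-letter
  pins `h𝔡d ∕ h𝔡s`, `hopD` (the kinematic schemas `DirSup37 ∧ DirSupHolder37`, derived in the certificate), `hcntI`, and THE ONE NEW DISPLAYED LEG `hopI` = Cor. 3.6's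
  `InputLegsPair37 ∧ FactorsInputPair37Dir` at the transported class `bHXT x U` (pin `hbHXT : bHXT x U = bHZPIfam … (taxiS … U)`); two pure numerics `3α ≦ (1−α_F)(1−2α)`,
  `β′ < sch β′` ((3.45)'s «β + ε»).  Conclusion `∃ M₂ a₀ > 0`, for every member above them and every regular `U`: (i) the displayed shape of `h44G` at the pins `(𝔬12 x).blk =
  blkBK (bI x)`, `(𝔬12 x).Dv ∕ .Dvstar = DvcoKH ∕ DvscoKH` (def-Y `Node00/OpsYOps312OfRecord`), kernel `B44·e^{−δ44 d}`, `δ44 = (1−α_F)(1−2α)δ₀ − 3αδ₀`; (ii) for every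
  `β′ ∈ [0,1)` the displayed shape of `hp45W` at `𝔭A x = holderProbesKA … parBY …`, kernel `B45(β′)·e^{−δ44 d}` with `K_pl` at the cap `a₁∕c` (member-independent).
HONEST SCOPE.  An assembler over landed theorems; Theorem 3.7's local legs (incl. the new transported input legs), the leaf, print's class are HYPOTHESES; nothing of [B9] asserted;
no certificate edition written; COUNT-NEUTRAL; N06 NOT discharged; nothing continuum, nothing about the mass gap.  Cell `pub-ymgap` (HUMAN RULING D-0062), Track A node N06 [B9],
seat `pub-ymgap-dag-n06-c` (g20), 2026-08-29; a NEW file; 0 `def`, no `sorry`, no `axiom`, no `instance`, no `notation`.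
-/

noncomputable section

namespace Literature.MathematicalPhysics.QuantumFieldTheory.Balaban1983to89.B9H44GFromPinsSN

open B6RandomWalk (HasMajorant c1_nonneg Ineq261 Triangle254)
open B6RandomWalkHom (HasMajorantHom hasMajorantHom_mono)
open B6GlobalChartV1 (PV blkV1)
open B6Geom246MultiLevelTorus (geomT)
open B6Ineq2142KLevelV1 (lvl β)
open B6KLevelCensusIndexV1 (KIdx kGeo)
open B6Prop22KLevelTorusCensusEta (nKT nKT_pos)
open B9Thm34Ext (toB6)
open B9Thm37Whole (Ops Conv342 Sizes StaticOK Local342)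
open B9RWSums343to347Whole (Facts347)
open B9RWSums346SecondDiffGp (DirOps37)
open B9RWSums346MixedPair (DirSup37)
open B9Thm37WholeDir (DirLetters37 DirSupSq37 Identities₂)
open B9Thm37KLetterDir (HolderV37Dir FactorsInputPair37Dir)
open B9RWSums343Holder (HolderProbes holderConst)
open B9RWSums343HolderGp (HolderLegs37)
open B9RWSums343HolderGpDir (holder343_of_local37_dir)
open B9RWSums344Input (inputConst44 inputConst45)
open B9RWSums344InputPair (InputLegsPair37 DirSupHolder37)
open B9RWSums344InputPairDir (inputPair3445_of_local37_dir)
open B9RWSums347DefiniteFaces (exp261 lemma21Pack_geo9Y)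
open B9GeoLemma21KLevelV1 (geo9Y_len_pos geo9Y_dist_triangle geo9Y_dist_comm geo9K_len_pos)
open B9GeoNormsKLevelV1 (geo9K geo9K_dist_nonneg)
open B9PinMembersKLevelV1 (MemberY geo9Y)
open B9Thm39ReadingCoords (coordBound39 basisBound39)
open B9CoReadingCoords (coordOpK XBK blkBK)
open B9CoReadingCoordsS (XSK blkSK sIK GcoS)
open B9CoReadingCoordsHolder (PK blkPK)
open B9CoReadingCoordsHolderAdm (holderProbesKA)
open B9CoReadingCoordsHolderSNear (holderProbesSN blkPX_SN)
open B9BackgroundsKLevelV1P (bg9KP)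
open B9Ineq349SiteComposite (cdSL cdsSL etaS_pos)
open Node00 (SiteY FBondY IBondY CfgY SiteOpY parSymY parSY parBY toKT etaS)
open Node00.OpsYSectDCoords (DvcoKH DvscoKH)
open Node00.OpsYNablaBridge (dirSliceK chartY)
open B9Eq340ProbeTransferSNY (hasMaj_probesSN_parSY_of_parSymY)
open B9Eq340DirSumReadOff (hasMaj_bond_of_dirSumFamily DvGcoSDvs_apply_eq_dirSum)
open B9Eq340ProbeReadOffKA (hasMaj_probesKA_of_dirSumFamily)
open B9SmoothHolderClassP (bHZKP)
open B9SmoothHolderClassPI (bHZPI bHZKPI bHZPIfam bHZPIfam_of_mem bHZPI_κ hasMaj_cNormR_zero_of_ofBlocks hasMaj_cNormR_of_target_rpow hasMaj_bHZKPI_of_bHZKP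
  hasMaj_bHZKP_of_bHZKPI len_le_transfer_geo9K transfer_threshold_geo9K hasMaj_dirSliceK_bHZKPI_bHZPI)
open B9GradViaDivLettersTransported (taxiS taxiB)
open B9MultiscaleSmoothPartitionYLip (CLip CLip_nonneg)
open B9MultiscaleSmoothPartitionYNear (rNear)
open B9Thm312Whole (GeoOK cNorm)
open B9Thm312WholeClasses (cNormR cNormR_loc cNormR_loc_neg_natCast hasMaj_cNormR_of_hasMajorantHom)
open T4RelativeLadder (UnitaryLike)
open B11SectG (BlockNorm HasMaj hasMaj_comp_exp RowSum rowSum_iff_ineq261)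
open scoped Matrix.Norms.L2Operator

variable {d ℓ : ℕ} {hd : 1 ≤ d + 1} {hL : Odd (ℓ + 1) ∧ 1 < ℓ + 1} {b₀ b₁ : ℝ} {Mstar : ℕ}
variable {N : ℕ} [Nonempty (Fin N)] {κ : Type} [Fintype κ] [DecidableEq κ]
variable [∀ x : MemberY d ℓ hd hL b₀ b₁ Mstar, Fintype (geo9Y x).Site] [∀ x : MemberY d ℓ hd hL b₀ b₁ Mstar, DecidableEq (geo9Y x).Site]

/-- Arithmetic of «for M sufficiently large» (the siblings' private lemma). [folklore] -/
private theorem small_of_size_pair {N' B₀ ex s θ₀ c M : ℝ} (hN' : 0 ≤ N') (hB : 0 ≤ B₀ * ex) (hc : 0 ≤ c) (hM : 0 < M)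
    (hs : s ≤ θ₀ * M⁻¹) (hbig : 2 * N' * (B₀ * ex * θ₀) * c ≤ M) : N' * (B₀ * ex * s) * c ≤ 1 / 2 := by
  have h1 : N' * (B₀ * ex * s) * c ≤ N' * (B₀ * ex * (θ₀ * M⁻¹)) * c :=
    mul_le_mul_of_nonneg_right (mul_le_mul_of_nonneg_left (mul_le_mul_of_nonneg_left hs hB) hN') hc
  have h2 : N' * (B₀ * ex * (θ₀ * M⁻¹)) * c = (N' * (B₀ * ex * θ₀) * c) / M := by
    rw [div_eq_mul_inv]; ring
  rw [h2] at h1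
  refine h1.trans ?_
  rw [div_le_iff₀ hM]
  linarith

/-- the Hölder constant is ≧ 0 for nonnegative letters (the engine's private lemma). [folklore] -/
private theorem holderConst_nonneg' {dd : ℕ} {δ₀ α NH NF C b t : ℝ} (hNH : 0 ≤ NH) (hNF : 0 ≤ NF) (hC : 0 ≤ C) (hb : 0 ≤ b)
    (ht : 0 ≤ t) : 0 ≤ holderConst dd δ₀ α NH NF C b t := by
  have hc1 : 0 ≤ B6.c1 dd δ₀ α := c1_nonneg dd δ₀ α
  unfold holderConst
  positivity

omit [Nonempty (Fin N)] [Fintype κ] [DecidableEq κ] [∀ x : MemberY d ℓ hd hL b₀ b₁ Mstar, Fintype (geo9Y x).Site]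
  [∀ x : MemberY d ℓ hd hL b₀ b₁ Mstar, DecidableEq (geo9Y x).Site] in
/-- the record geometry is a `GeoOK` geometry. [cite: Balaban1984PropagatorsII, (2.46)–(2.47) p.231, bookkeeping] -/
private theorem geoOK_geo9Y (x : MemberY d ℓ hd hL b₀ b₁ Mstar) : GeoOK (geo9K x.toKIdx) :=
  ⟨geo9Y_dist_triangle x, geo9Y_dist_comm x, geo9K_dist_nonneg x.toKIdx, geo9Y_len_pos x⟩
set_option maxHeartbeats 400000 in
/-- ★★★ **`h44G` AND `hp45W` FROM THE ROWS-18 DATA AND COR. 3.6's TRANSPORTED INPUT LEGS AT THE NEAR SITE CARRIER.**  See the module docstring.  Constants (member-independent):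
`L = ℓ+1`, `C_σ = L·L³(2 + 2c_bb_bL²)·e^{(1−α_F)(1−2α)δ₀·r_σ}`, `r_σ = 2(r_near+1) + ((d+1)(L+1)+2)`, `κ₂ = 1 + C_Lip`, `c₁ = c₁(d_E, δ₀, α)`, `K₄₄(s) = inputConst44 …`,
`B44 = L·(d+1)·κ₂·K₄₄(s44)·C_σ·c₁`; `B45(β′)` = the probe read-off constant with `K_pl` at the cap `a₁∕c`.
[cite: Balaban1985BackgroundPropagators, Thm 3.7 p.409 + «Theorem 3.7 implies (3.42)–(3.47)» p.410 + Cor. 3.6 p.408 + (3.44)–(3.45) p.398 + (3.40) p.397 + (3.35) p.396 + (3.8) p.392; Balaban1984PropagatorsII, (2.51)–(2.56) pp.232–233 + Lemma 2.1 (2.60)–(2.61) p.234] -/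
theorem h44G_hp45W_of_thm37PrintedSN {G : Subgroup (Matrix (Fin N) (Fin N) ℂ)ˣ} (hG1 : ∀ u : (Matrix (Fin N) (Fin N) ℂ)ˣ, u ∈ G → ‖(u : Matrix (Fin N) (Fin N) ℂ)‖ ≤ 1)
    {bg : MemberY d ℓ hd hL b₀ b₁ Mstar → B9.Backgrounds} (cfg : ∀ x : MemberY d ℓ hd hL b₀ b₁ Mstar, (bg x).Cfg → CfgY (Matrix (Fin N) (Fin N) ℂ) x.toKIdx)
    (b : Module.Basis κ ℝ (Matrix (Fin N) (Fin N) ℂ)) {c35 c10 : ℝ} (hc10 : c10 ≤ 10)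
    (hP : ∀ (x : MemberY d ℓ hd hL b₀ b₁ Mstar) (α₀ : ℝ) (U : (bg x).Cfg), (bg x).Reg335 c35 α₀ U →
      (bg9KP (Matrix (Fin N) (Fin N) ℂ) G x.toKIdx).Reg335 c10 α₀ (cfg x U))
    {ι : MemberY d ℓ hd hL b₀ b₁ Mstar → Type} [∀ x, Fintype (ι x)]
    (𝔬 : ∀ x : MemberY d ℓ hd hL b₀ b₁ Mstar, Ops (geo9Y x) (bg x) (XSK κ x.toKIdx) (XSK κ x.toKIdx) (ι x))
    (𝔡 : ∀ x : MemberY d ℓ hd hL b₀ b₁ Mstar, DirOps37 (𝔬 x) (Fin (d + 1))) (𝔩 : ∀ x : MemberY d ℓ hd hL b₀ b₁ Mstar, DirLetters37 (𝔬 x) (Fin (d + 1)))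
    (𝔭 : ∀ x : MemberY d ℓ hd hL b₀ b₁ Mstar,
      HolderProbes (geo9Y x) (bg x) (XSK κ x.toKIdx) (XSK κ x.toKIdx) (PK (SiteY x.toKIdx) (Fin (d + 1)) κ) (PK (SiteY x.toKIdx) (Fin (d + 1)) κ))
    (H : MemberY d ℓ hd hL b₀ b₁ Mstar → Prop) (O : ∀ x : MemberY d ℓ hd hL b₀ b₁ Mstar, SiteOpY (Matrix (Fin N) (Fin N) ℂ) x.toKIdx)
    {bI : ∀ x : MemberY d ℓ hd hL b₀ b₁ Mstar, FBondY x.toKIdx → IBondY x.toKIdx}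
    (hlev : ∀ (x : MemberY d ℓ hd hL b₀ b₁ Mstar) (f : FBondY x.toKIdx), lvl x.toKIdx.hN x.toKIdx.D x.toKIdx.hk (bI x f) = (blkV1 x.toKIdx.hN x.toKIdx.D f).1.1)
    (hβ1 : ∀ (x : MemberY d ℓ hd hL b₀ b₁ Mstar) (f : FBondY x.toKIdx),
      (geomT x.toKIdx.D).dist (β x.toKIdx.hN x.toKIdx.D x.toKIdx.hk (bI x f)) (blkV1 x.toKIdx.hN x.toKIdx.D f) ≤ 1)
    (hbI0 : ∀ (x : MemberY d ℓ hd hL b₀ b₁ Mstar) (f : FBondY x.toKIdx), bI x f = bI x ⟨f.src, 0⟩)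
    (hcf : ∀ x : MemberY d ℓ hd hL b₀ b₁ Mstar, |x.toKIdx.cf| = (nKT (toKT x.toKIdx) : ℝ))
    (h𝔭 : ∀ x : MemberY d ℓ hd hL b₀ b₁ Mstar, 𝔭 x = holderProbesSN x.toKIdx b (bg x) (cfg x) (parSymY x.toKIdx) (bI x))
    (hblk : ∀ x : MemberY d ℓ hd hL b₀ b₁ Mstar, (𝔬 x).blk = blkSK x.toKIdx (sIK x.toKIdx (bI x)))
    (hGp : ∀ (x : MemberY d ℓ hd hL b₀ b₁ Mstar) (U : (bg x).Cfg), (𝔬 x).Gp U = GcoS x.toKIdx b (bg x) (cfg x) (O x) U)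
    (h𝔡d : ∀ (x : MemberY d ℓ hd hL b₀ b₁ Mstar) (U : (bg x).Cfg) (ν : Fin (d + 1)),
      (𝔡 x).Dd U ν = (etaS x.toKIdx)⁻¹ • coordOpK b (fun _ : Fin (d + 1) => (cdSL x.toKIdx (cfg x U) ν).restrictScalars ℝ))
    (h𝔡s : ∀ (x : MemberY d ℓ hd hL b₀ b₁ Mstar) (U : (bg x).Cfg) (μ : Fin (d + 1)),
      (𝔡 x).Dsd U μ = (etaS x.toKIdx)⁻¹ • coordOpK b (fun _ : Fin (d + 1) => (cdsSL x.toKIdx (cfg x U) μ).restrictScalars ℝ))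
    (bHXT : ∀ x : MemberY d ℓ hd hL b₀ b₁ Mstar, (bg x).Cfg → ℝ → BlockNorm (toB6 (geo9Y x) 1 (H x)) (XSK κ x.toKIdx → ℝ))
    (hbHXT : ∀ (x : MemberY d ℓ hd hL b₀ b₁ Mstar) (U : (bg x).Cfg), bHXT x U = fun ε =>
      letI : Fintype (geo9K x.toKIdx).Site := (inferInstance : Fintype (geo9Y x).Site)
      bHZPIfam (κ := κ) x.toKIdx b (taxiS x.toKIdx (bg x) (cfg x) U) (R := (1 : ℝ)) (H := H x) ε)
    (κS : MemberY d ℓ hd hL b₀ b₁ Mstar → Sizes) (SH SI : ∀ x : MemberY d ℓ hd hL b₀ b₁ Mstar, ι x → Finset (geo9Y x).Site)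
    {α ρ Nn N' Cℓ Kc θ₀ B₀ δ₀ a₁ M₁ NH NI αF C δ : ℝ} (Bl BV BI θI : ℝ → ℝ) (BI2 : ℝ → ℝ → ℝ) (sch : ℝ → ℝ)
    (hc : 0 < c35) (hα : 0 < α) (hα2 : α < 1 / 2) (hN' : 0 ≤ N') (hNH : 0 ≤ NH) (hNI : 0 ≤ NI) (hB₀ : 0 < B₀) (hδ₀ : 0 < δ₀) (ha₁ : 0 < a₁) (hM₁ : 0 < M₁)
    (hαF : 0 < αF) (hαF1 : αF < 1) (hα3 : 3 * α ≤ (1 - αF) * (1 - 2 * α)) (hC : 0 ≤ C) (hδF : (1 - 2 * α) * δ₀ ≤ δ)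
    (hBl : ∀ β', 0 ≤ β' → β' < 1 → 0 ≤ Bl β') (hBV : ∀ β', 0 ≤ β' → β' < 1 → 0 ≤ BV β')
    (hBI : ∀ ε, 0 < ε → ε ≤ 1 → 0 ≤ BI ε) (hBI2 : ∀ ε β', 0 < ε → ε ≤ 1 → 0 ≤ β' → β' < 1 → 0 ≤ BI2 ε β') (hθI : ∀ ε, 0 < ε → 0 ≤ θI ε)
    (hschβ : ∀ β', 0 ≤ β' → β' < 1 → β' < sch β') (hsch1 : ∀ β', 0 ≤ β' → β' < 1 → sch β' < 1)
    (hst : ∀ x, StaticOK (𝔬 x) ρ Nn N' Cℓ (κS x)) (hκ : ∀ x, (κS x).Bounded Kc θ₀ Cℓ (geo9Y x).M)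
    (hcntH : ∀ x (a : (geo9Y x).Site), (∑ q, if a ∈ SH x q then (1 : ℝ) else 0) ≤ NH)
    (hcntI : ∀ x (a : (geo9Y x).Site), (∑ q, if a ∈ SI x q then (1 : ℝ) else 0) ≤ NI)
    (hop : ∀ x, M₁ ≤ (geo9Y x).M → ∀ α₀ : ℝ, 0 < α₀ → c35 * (geo9Y x).M * α₀ ≤ a₁ →
      ∀ U : (bg x).Cfg, (bg x).Reg335 c35 α₀ U →
        Local342 (𝔬 x) 1 (H x) B₀ δ₀ U ∧ DirSupSq37 (𝔬 x) (𝔡 x) 1 (H x) U ∧ Identities₂ (𝔬 x) (𝔡 x) (𝔩 x) 1 (H x) U ∧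
          HolderLegs37 (𝔬 x) (𝔭 x) 1 (H x) (SH x) Bl δ₀ U ∧ HolderV37Dir (𝔬 x) (𝔡 x) (𝔩 x) (𝔭 x) 1 (H x) BV δ₀ U)
    (hopD : ∀ x, M₁ ≤ (geo9Y x).M → ∀ α₀ : ℝ, 0 < α₀ → c35 * (geo9Y x).M * α₀ ≤ a₁ →
      ∀ U : (bg x).Cfg, (bg x).Reg335 c35 α₀ U → DirSup37 (𝔬 x) (𝔡 x) 1 (H x) U ∧ DirSupHolder37 (𝔬 x) (𝔡 x) (𝔭 x) 1 (H x) U)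
    (hopI : ∀ x, M₁ ≤ (geo9Y x).M → ∀ α₀ : ℝ, 0 < α₀ → c35 * (geo9Y x).M * α₀ ≤ a₁ →
      ∀ U : (bg x).Cfg, (bg x).Reg335 c35 α₀ U →
        InputLegsPair37 (𝔬 x) (𝔡 x) (𝔭 x) 1 (H x) (bHXT x U) (SI x) BI BI2 δ₀ U ∧ FactorsInputPair37Dir (𝔬 x) (𝔡 x) (𝔩 x) 1 (H x) (bHXT x U) θI δ₀ U)
    (E : ∀ x : MemberY d ℓ hd hL b₀ b₁ Mstar, B9.RWExpansion (geo9Y x) (bg x)) (t37 : B9.Thm37Printed c35 (fun x => geo9Y x) bg E)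
    (hconv : ∀ (x : MemberY d ℓ hd hL b₀ b₁ Mstar) (U : (bg x).Cfg), (E x).Converges U → Conv342 (𝔬 x) 1 (H x) C δ U)
    {s : ℝ} (hs0 : 0 < s) (hs1 : s < 1) :
    ∃ M₂ a₀ : ℝ, 0 < M₂ ∧ 0 < a₀ ∧
      ∀ x : MemberY d ℓ hd hL b₀ b₁ Mstar, letI : Fintype (geo9K x.toKIdx).Site := (inferInstance : Fintype (geo9Y x).Site)
        M₂ ≤ (geo9Y x).M → ∀ α₀ : ℝ, 0 < α₀ → (geo9Y x).M * α₀ ≤ a₀ →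
        ∀ U : (bg x).Cfg, (bg x).Reg335 c35 α₀ U →
          HasMaj (bHZKP (κ := κ) x.toKIdx b (taxiB x.toKIdx (bg x) (cfg x) U) (R := (1 : ℝ)) (H := H x) hs0.le hs1.le)
            (cNorm 1 (H x) (blkBK x.toKIdx (bI x)) (geoOK_geo9Y x).lenle 1)
            (DvcoKH x.toKIdx b (bg x) (cfg x) U ∘ₗ (GcoS x.toKIdx b (bg x) (cfg x) (O x) U ∘ₗ DvscoKH x.toKIdx b (bg x) (cfg x) U))
            (fun a a' => (((ℓ + 1 : ℕ) : ℝ)) * ((((d + 1 : ℕ) : ℝ)) * ((1 + CLip d ℓ) * inputConst44 (exp261 (@geo9Y d ℓ hd hL b₀ b₁ Mstar) δ₀ α) δ₀ α NI N' C (((ℓ + 1 : ℕ) : ℝ)) (BI s) (θI s) * ((((ℓ + 1 : ℕ) : ℝ)) * ((((ℓ + 1 : ℕ) : ℝ)) ^ 3 * (2 + 2 * coordBound39 b * basisBound39 b * (((ℓ + 1 : ℕ) : ℝ)) ^ 2)) * Real.exp ((1 - αF) * ((1 - 2 * α) * δ₀) * (2 * (rNear d ℓ + 1) + (((d : ℝ)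 + 1) * (((ℓ : ℝ) + 1) + 1) + 2)))) * B6.c1 (exp261 (@geo9Y d ℓ hd hL b₀ b₁ Mstar) δ₀ α) δ₀ α)) *
              Real.exp (-(((1 - αF) * ((1 - 2 * α) * δ₀) - 3 * (α * δ₀)) * (geo9Y x).dist a a'))) ∧
          ∀ (β' : ℝ) (h0 : 0 ≤ β') (h1 : β' < 1),
            HasMaj (bHZKP (κ := κ) x.toKIdx b (taxiB x.toKIdx (bg x) (cfg x) U) (R := (1 : ℝ)) (H := H x) (s := sch β')
                (h0.trans (hschβ β' h0 h1).le) (hsch1 β' h0 h1).le)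
              (cNormR 1 (H x) (blkPK (bI x)) (geoOK_geo9Y x).lenle (β' - 1))
              ((holderProbesKA x.toKIdx b (bg x) (cfg x) (parBY x.toKIdx) (bI x)).ΦX U β' ∘ₗ
                (DvcoKH x.toKIdx b (bg x) (cfg x) U ∘ₗ (GcoS x.toKIdx b (bg x) (cfg x) (O x) U ∘ₗ DvscoKH x.toKIdx b (bg x) (cfg x) U)))
              (fun a a' => (((d + 1 : ℕ) : ℝ)) * ((((((ℓ + 1 : ℕ) : ℝ)) * ((1 + CLip d ℓ) * inputConst45 (exp261 (@geo9Y d ℓ hd hL b₀ b₁ Mstar) δ₀ α) δ₀ α NI N' (((ℓ + 1 : ℕ) : ℝ)) (holderConst (exp261 (@geo9Y d ℓ hd hL b₀ b₁ Mstar) δ₀ α) δ₀ α NH N' C (Bl β') (BV β')) (BI2 (sch β' - β') β') (θI (sch β')) * ((((ℓ + 1 : ℕ) : ℝ)) * ((((ℓ + 1 : ℕ) : ℝ)) ^ 3 * (2 + 2 * coordBound39 b * basisBound39 b * (((ℓ + 1 : ℕ) : ℝ)) ^ 2)) * Real.exp ((1 - αF) * ((1 - 2 * α) * δ₀) * (2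 * (rNear d ℓ + 1) + (((d : ℝ) + 1) * (((ℓ : ℝ) + 1) + 1) + 2)))) * B6.c1 (exp261 (@geo9Y d ℓ hd hL b₀ b₁ Mstar) δ₀ α) δ₀ α)) + 2 * coordBound39 b * basisBound39 b * ((ℓ : ℝ) + 1) * Real.exp (((1 - αF) * ((1 - 2 * α) * δ₀) - 3 * (α * δ₀)) * (((d : ℝ) + 1) * (((ℓ : ℝ) + 1) + 1) + 2)) * ((((d + 1 : ℕ) : ℝ)) ^ 2 * (2 * (10 * (((ℓ + 1 : ℕ) : ℝ)) * (a₁ / c35)) * (1 + 10 * (((ℓ + 1 : ℕ) : ℝ)) * (a₁ / c35)) * Real.exp (4 * (10 * (((ℓ + 1 : ℕ) : ℝ)) * (a₁ / c35)))) * (((ℓ + 1 : ℕ) : ℝ)) ^ 6) * ((((ℓ + 1 : ℕ) : ℝ)) * ((1 + CLip d ℓ) * inputConst44 (exp261 (@geo9Y d ℓ hd hL b₀ b₁ Mstar) δ₀ α) δ₀ α NI N' C (((ℓ + 1 : ℕ) : ℝ)) (BI (sch β')) (θI (sch β')) * ((((ℓ + 1 : ℕ) : ℝ)) * ((((ℓ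 + 1 : ℕ) : ℝ)) ^ 3 * (2 + 2 * coordBound39 b * basisBound39 b * (((ℓ + 1 : ℕ) : ℝ)) ^ 2)) * Real.exp ((1 - αF) * ((1 - 2 * α) * δ₀) * (2 * (rNear d ℓ + 1) + (((d : ℝ) + 1) * (((ℓ : ℝ) + 1) + 1) + 2)))) * B6.c1 (exp261 (@geo9Y d ℓ hd hL b₀ b₁ Mstar) δ₀ α) δ₀ α)) + coordBound39 b * basisBound39 b * ((((ℓ + 1 : ℕ) : ℝ)) * ((1 + CLip d ℓ) * inputConst44 (exp261 (@geo9Y d ℓ hd hL b₀ b₁ Mstar) δ₀ α) δ₀ α NI N' C (((ℓ + 1 : ℕ) : ℝ)) (BI (sch β')) (θI (sch β')) * ((((ℓ + 1 : ℕ) : ℝ)) * ((((ℓ + 1 : ℕ) : ℝ)) ^ 3 * (2 + 2 * coordBound39 b * basisBound39 b * (((ℓ + 1 : ℕ) : ℝ)) ^ 2)) * Real.exp ((1 - αF) * ((1 - 2 * α) * δ₀) * (2 * (rNear d ℓ + 1) + (((d : ℝ) + 1) * (((ℓ : ℝ) + 1) + 1) + 2)))) * B6.c1 (exp261 (@geo9Y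 d ℓ hd hL b₀ b₁ Mstar) δ₀ α) δ₀ α)) + ((((ℓ + 1 : ℕ) : ℝ)) * ((1 + CLip d ℓ) * inputConst44 (exp261 (@geo9Y d ℓ hd hL b₀ b₁ Mstar) δ₀ α) δ₀ α NI N' C (((ℓ + 1 : ℕ) : ℝ)) (BI (sch β')) (θI (sch β')) * ((((ℓ + 1 : ℕ) : ℝ)) * ((((ℓ + 1 : ℕ) : ℝ)) ^ 3 * (2 + 2 * coordBound39 b * basisBound39 b * (((ℓ + 1 : ℕ) : ℝ)) ^ 2)) * Real.exp ((1 - αF) * ((1 - 2 * α) * δ₀) * (2 * (rNear d ℓ + 1) + (((d : ℝ) + 1) * (((ℓ : ℝ) + 1) + 1) + 2)))) * B6.c1 (exp261 (@geo9Y d ℓ hd hL b₀ b₁ Mstar) δ₀ α) δ₀ α))) + ((((ℓ + 1 : ℕ) : ℝ)) * ((1 + CLip d ℓ) * inputConst44 (exp261 (@geo9Y d ℓ hd hL b₀ b₁ Mstar) δ₀ α) δ₀ α NI N' C (((ℓ + 1 : ℕ) : ℝ)) (BI (sch β')) (θI (sch β')) * ((((ℓ + 1 : ℕ) : ℝ))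 * ((((ℓ + 1 : ℕ) : ℝ)) ^ 3 * (2 + 2 * coordBound39 b * basisBound39 b * (((ℓ + 1 : ℕ) : ℝ)) ^ 2)) * Real.exp ((1 - αF) * ((1 - 2 * α) * δ₀) * (2 * (rNear d ℓ + 1) + (((d : ℝ) + 1) * (((ℓ : ℝ) + 1) + 1) + 2)))) * B6.c1 (exp261 (@geo9Y d ℓ hd hL b₀ b₁ Mstar) δ₀ α) δ₀ α)) + coordBound39 b * basisBound39 b * ((((ℓ + 1 : ℕ) : ℝ)) * ((1 + CLip d ℓ) * inputConst44 (exp261 (@geo9Y d ℓ hd hL b₀ b₁ Mstar) δ₀ α) δ₀ α NI N' C (((ℓ + 1 : ℕ) : ℝ)) (BI (sch β')) (θI (sch β')) * ((((ℓ + 1 : ℕ) : ℝ)) * ((((ℓ + 1 : ℕ) : ℝ)) ^ 3 * (2 + 2 * coordBound39 b * basisBound39 b * (((ℓ + 1 : ℕ) : ℝ)) ^ 2)) * Real.exp ((1 - αF) * ((1 - 2 * α) * δ₀) * (2 * (rNear d ℓ + 1) + (((d : ℝ) + 1) * (((ℓ : ℝ) + 1) + 1) + 2)))) * B6.c1 (exp261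 (@geo9Y d ℓ hd hL b₀ b₁ Mstar) δ₀ α) δ₀ α))) *
                Real.exp (-(((1 - αF) * ((1 - 2 * α) * δ₀) - 3 * (α * δ₀)) * (geo9Y x).dist a a'))) := by
  classical
  -- names for the constants: the goal is rewritten in these names, then they are made opaque (`clear_value`)
  set L : ℝ := ((ℓ + 1 : ℕ) : ℝ) with hLdef
  set dE : ℕ := exp261 (@geo9Y d ℓ hd hL b₀ b₁ Mstar) δ₀ α with hdE
  set δF : ℝ := (1 - 2 * α) * δ₀ with hδFdef
  set ρE : ℝ := (1 - αF) * δF with hρEdef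
  set Cσ : ℝ := L * (L ^ 3 * (2 + 2 * coordBound39 b * basisBound39 b * L ^ 2)) *
    Real.exp (ρE * (2 * (rNear d ℓ + 1) + (((d : ℝ) + 1) * (((ℓ : ℝ) + 1) + 1) + 2))) with hCσ
  clear_value Cσ ρE δF dE L
  have hL1 : (1 : ℝ) ≤ L := by rw [hLdef]; exact_mod_cast Nat.succ_le_succ (Nat.zero_le ℓ)
  have hL0 : 0 ≤ L := zero_le_one.trans hL1
  have hcb : 0 ≤ coordBound39 b := by unfold coordBound39; exact norm_nonneg _
  have hbb : 0 ≤ basisBound39 b := Finset.sum_nonneg fun _ _ => norm_nonneg _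
  have hκ₂0 : 0 ≤ 1 + CLip d ℓ := add_nonneg zero_le_one (CLip_nonneg d ℓ)
  have hc₁0 : 0 ≤ B6.c1 dE δ₀ α := c1_nonneg dE δ₀ α
  have hδF0 : 0 < δF := by rw [hδFdef]; exact mul_pos (by linarith only [hα2]) hδ₀
  have hρE0 : 0 < ρE := by rw [hρEdef]; exact mul_pos (by linarith only [hαF1]) hδF0
  have hCσ0 : 0 ≤ Cσ := by rw [hCσ]; positivity
  have hσ₀0 : 0 < α * δ₀ := mul_pos hα hδ₀
  have hρE3 : 3 * (α * δ₀) ≤ ρE := by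
    rw [hρEdef, hδFdef]
    have := mul_le_mul_of_nonneg_right hα3 hδ₀.le
    linarith only [this]
  have hr3 : ρE - 2 * (α * δ₀) - α * δ₀ = ρE - 3 * (α * δ₀) := by ring
  -- the leaf's thresholds, the record's (2.61) ∕ Facts347 thresholds, the smallness and transfer thresholds
  obtain ⟨M₂, a₂, hM₂, ha₂, h37⟩ := t37
  obtain ⟨Mth, h261, hF, -⟩ := lemma21Pack_geo9Y (d := d) (ℓ := ℓ) (hd := hd) (hL := hL) (b₀ := b₀) (b₁ := b₁) (Mstar := Mstar) H hα hα2 hδ₀ hαF hαF1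
  rw [← hdE] at h261
  rw [← hδFdef, ← hLdef] at hF
  have hBe : 0 ≤ B₀ * Real.exp (δ₀ * ρ) := mul_nonneg hB₀.le (Real.exp_nonneg _)
  refine ⟨max (max (max M₂ M₁) (max Mth (2 * N' * (B₀ * Real.exp (δ₀ * ρ) * θ₀) * B6.c1 dE δ₀ α)))
      (Real.log L / (α * δ₀ * (2 * ((ℓ : ℝ) + 1) ^ 2 - 1))), min a₂ (a₁ / c35),
    lt_max_of_lt_left (lt_max_of_lt_left (lt_max_of_lt_left hM₂)), lt_min ha₂ (div_pos ha₁ hc), ?_⟩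
  intro x
  letI : Fintype (geo9K x.toKIdx).Site := (inferInstance : Fintype (geo9Y x).Site)
  intro hM α₀ hα₀ hMa U hU
  have hM' := (le_max_left _ _).trans hM
  have hM₂x : M₂ ≤ (geo9Y x).M := le_trans (le_trans (le_max_left _ _) (le_max_left _ _)) hM'
  have hM₁x : M₁ ≤ (geo9Y x).M := le_trans (le_trans (le_max_right _ _) (le_max_left _ _)) hM'
  have hMthx : Mth ≤ (geo9Y x).M := le_trans (le_trans (le_max_left _ _) (le_max_right _ _)) hM'
  have hMb : 2 * N' * (B₀ * Real.exp (δ₀ * ρ) * θ₀) * B6.c1 dE δ₀ α ≤ (geo9Y x).M := le_trans (le_trans (le_max_right _ _) (le_max_right _ _)) hM'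
  have hMtrx : Real.log L / (α * δ₀ * (2 * ((ℓ : ℝ) + 1) ^ 2 - 1)) ≤ (geo9K x.toKIdx).M := (le_max_right _ _).trans hM
  have hMpos : 0 < (geo9Y x).M := lt_of_lt_of_le hM₁ hM₁x
  have hMa₂ : (geo9Y x).M * α₀ ≤ a₂ := hMa.trans (min_le_left _ _)
  have hMa₁ : (geo9Y x).M * α₀ ≤ a₁ / c35 := hMa.trans (min_le_right _ _)
  have ha : c35 * (geo9Y x).M * α₀ ≤ a₁ := by
    have h2 : (geo9Y x).M * α₀ * c35 ≤ a₁ := (le_div_iff₀ hc).mp hMa₁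
    calc c35 * (geo9Y x).M * α₀ = (geo9Y x).M * α₀ * c35 := by ring
      _ ≤ a₁ := h2
  have hGeo : GeoOK (geo9K x.toKIdx) := geoOK_geo9Y x
  -- the leaf: (3.42)'s sup majorants of the sum, weakened to the Facts347 rate `δF ≤ δ`
  have hconvU : Conv342 (𝔬 x) 1 (H x) C δ U := hconv x U (h37 x hM₂x α₀ hα₀ hMa₂ U hU)
  obtain ⟨-, h1, h2, -⟩ := hconvU
  have hexpF : ∀ a a' : (geo9Y x).Site, Real.exp (-(δ * (geo9Y x).dist a a')) ≤ Real.exp (-(δF * (geo9Y x).dist a a')) := fun a a' =>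
    Real.exp_le_exp.mpr (neg_le_neg (mul_le_mul_of_nonneg_right hδF (geo9K_dist_nonneg x.toKIdx a a')))
  have h1F : HasMajorantHom (g := toB6 (geo9Y x) 1 (H x)) (𝔬 x).blk (𝔬 x).blkY ((𝔬 x).D U ∘ₗ (𝔬 x).Gp U)
      (fun a a' => C * (geo9Y x).len a * Real.exp (-(δF * (geo9Y x).dist a a'))) :=
    hasMajorantHom_mono (g := toB6 (geo9Y x) 1 (H x)) _ _ h1 fun a a' =>
      mul_le_mul_of_nonneg_left (hexpF a a') (mul_nonneg hC (geo9Y_len_pos x a).le)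
  have h2F : HasMajorantHom (g := toB6 (geo9Y x) 1 (H x)) (𝔬 x).blkY (𝔬 x).blk ((𝔬 x).Gp U ∘ₗ (𝔬 x).Dstar U)
      (fun a a' => C * (geo9Y x).len a * Real.exp (-(δF * (geo9Y x).dist a a'))) :=
    hasMajorantHom_mono (g := toB6 (geo9Y x) 1 (H x)) _ _ h2 fun a a' =>
      mul_le_mul_of_nonneg_left (hexpF a a') (mul_nonneg hC (geo9Y_len_pos x a).le)
  -- the local inputs and the smallness
  obtain ⟨hl, hT, hid, hLg, hV⟩ := hop x hM₁x α₀ hα₀ ha U hU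
  obtain ⟨hDS, hDH⟩ := hopD x hM₁x α₀ hα₀ ha U hU
  obtain ⟨hIL, hFI⟩ := hopI x hM₁x α₀ hα₀ ha U hU
  have hq : N' * (B₀ * Real.exp (δ₀ * ρ) * ((κS x).kP + (κS x).kC)) * B6.c1 dE δ₀ α ≤ 1 / 2 :=
    small_of_size_pair hN' hBe hc₁0 hMpos (hκ x).row hMb
  -- the rows-18 LEFT Hölder member for every β (the engine's `hHol`), at the rate δF
  have hδFle : δF ≤ (1 - α) * δ₀ := by rw [hδFdef]; have := mul_pos hα hδ₀; linarith only [this]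
  have hHol : ∀ β' : ℝ, 0 ≤ β' → β' < 1 →
      HasMajorantHom (g := toB6 (geo9Y x) 1 (H x)) (𝔬 x).blk (𝔭 x).blkPY (((𝔭 x).ΦY U β' ∘ₗ (𝔬 x).D U) ∘ₗ (𝔬 x).Gp U)
        (fun a a' => holderConst dE δ₀ α NH N' C (Bl β') (BV β') * (geo9Y x).len a ^ (1 - β') * Real.exp (-(δF * (geo9Y x).dist a a'))) :=
    fun β' hβ0 hβlt => (holder343_of_local37_dir (𝔬 x) (𝔡 x) (𝔩 x) (𝔭 x) 1 (H x) dE δ₀ α ρ B₀ Nn N' Cℓ NH C δF (κS x) (SH x) Bl BV U hB₀.le hδ₀.le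
      hα.le (by linarith only [hα2]) hN' hNH hC hδF0.le hδFle (hst x) (hκ x).nonneg (hcntH x) hBl hBV (h261 x hMthx) hq hl hT hid hLg hV h2F β' hβ0 hβlt).1
  -- the engine: the (3.44)∕(3.45) members of the sum per direction pair, at the transported print-exact site class
  have hαδ0 : 0 ≤ αF * δF := (mul_pos hαF hδF0).le
  have hαδ1 : αF * δF ≤ δF := mul_le_of_le_one_left hδF0.le hαF1.le
  have hhc : ∀ β', 0 ≤ β' → β' < 1 → 0 ≤ holderConst dE δ₀ α NH N' C (Bl β') (BV β') := fun β' hβ0 hβ1 =>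
    holderConst_nonneg' hNH hN' hC (hBl β' hβ0 hβ1) (hBV β' hβ0 hβ1)
  have hEng := fun ν μ : Fin (d + 1) => inputPair3445_of_local37_dir (𝔬 x) (𝔡 x) (𝔩 x) (𝔭 x) 1 (H x) (bHXT x U)
    (exp261 (@geo9Y d ℓ hd hL b₀ b₁ Mstar) δF (1 - αF)) dE δF αF L δ₀ α ρ Nn N' Cℓ NI C (κS x) (SI x)
    (fun β' => holderConst dE δ₀ α NH N' C (Bl β') (BV β')) BI θI BI2 U hδ₀.le hα.le hN' hNI hC hδFle hαδ0 hαδ1 (hst x) (hcntI x) hhc hBI hBI2 hθI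
    (h261 x hMthx) (hF x hMthx) hid hIL hFI hDS hDH h1F hHol ν μ
  -- print's class and unitarity; the row sum at `αδ₀`; the (2.60) transfer at `αδ₀`
  have hreg := hP x α₀ U hU
  have hMα : 0 ≤ (kGeo x.toKIdx).M * α₀ := by
    have : (kGeo x.toKIdx).M = (geo9Y x).M := rfl
    rw [this]; exact (mul_pos hMpos hα₀).le
  have hUn : ∀ μ t, UnitaryLike (cfg x U μ t) := fun μ t =>
    B9SectBGpLettersY.norm_le_one_and_inv_of_mem G hG1 (B9BackgroundsKLevelV1P.mem_of_reg335P x.toKIdx hreg μ t)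
  have hrow : RowSum (toB6 (geo9K x.toKIdx) 1 (H x)) (α * δ₀) (B6.c1 dE δ₀ α) := (rowSum_iff_ineq261 dE (toB6 (geo9Y x) 1 (H x)) δ₀ α).1 (h261 x hMthx)
  have htri : Triangle254 (toB6 (geo9K x.toKIdx) 1 (H x)) := fun a b c => hGeo.tri a b c
  have hMtr' : Real.log (geo9K x.toKIdx).L ≤ α * δ₀ * (2 * ((ℓ : ℝ) + 1) ^ 2 - 1) * (geo9K x.toKIdx).M :=
    transfer_threshold_geo9K x.toKIdx hσ₀0 (by rw [hLdef] at hMtrx; exact hMtrx)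
  have hTr := len_le_transfer_geo9K x.toKIdx hσ₀0 hMtr'
  rw [← hLdef] at hTr
  have hγ1 : |x.toKIdx.cf| * etaS x.toKIdx = 1 := by
    rw [hcf x]; unfold etaS
    exact mul_inv_cancel₀ (nKT_pos (toKT x.toKIdx)).ne'
  have hγ : |(x.toKIdx.cf * etaS x.toKIdx) ^ 2| = 1 := by
    rw [abs_pow, abs_mul, abs_of_pos (etaS_pos x.toKIdx), hγ1, one_pow]
  -- the directional words and the bond word as their direction sum
  set W : Fin (d + 1) → Fin (d + 1) → Module.End ℝ (XSK κ x.toKIdx → ℝ) := fun ν μ =>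
    ((etaS x.toKIdx)⁻¹ • coordOpK b (fun _ : Fin (d + 1) => (cdSL x.toKIdx (cfg x U) ν).restrictScalars ℝ)) ∘ₗ
      (GcoS x.toKIdx b (bg x) (cfg x) (O x) U ∘ₗ ((etaS x.toKIdx)⁻¹ • coordOpK b (fun _ : Fin (d + 1) => (cdsSL x.toKIdx (cfg x U) μ).restrictScalars ℝ))) with hW
  set S : Fin (d + 1) → Fin (d + 1) → Fin (d + 1) → (XBK κ x.toKIdx → ℝ) →ₗ[ℝ] (XSK κ x.toKIdx → ℝ) := fun dir ν μ =>
    W dir μ ∘ₗ dirSliceK x.toKIdx μ ν with hS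
  have hT : ∀ (A : XBK κ x.toKIdx → ℝ) (f : FBondY x.toKIdx) (ν : Fin (d + 1)) (c c' : κ),
      (DvcoKH x.toKIdx b (bg x) (cfg x) U ∘ₗ (GcoS x.toKIdx b (bg x) (cfg x) (O x) U ∘ₗ DvscoKH x.toKIdx b (bg x) (cfg x) U)) A (f, ν, c, c') =
        (x.toKIdx.cf * etaS x.toKIdx) ^ 2 * ∑ μ : Fin (d + 1), S f.dir ν μ A (chartY x.toKIdx f.src, μ, c, c') :=
    fun A f ν c c' => DvGcoSDvs_apply_eq_dirSum x.toKIdx b (cfg x) (O x) U A f ν c c'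
  -- the engine's (3.44) member at the pins, as a `𝔠^{(0)}` target, for EVERY exponent `t ∈ (0,1)`
  have hE44 : ∀ (t : ℝ) (ht0 : 0 < t) (ht1 : t < 1) (ν μ : Fin (d + 1)),
      HasMaj (bHZPI (κ := κ) x.toKIdx b (taxiS x.toKIdx (bg x) (cfg x) U) (R := (1 : ℝ)) (H := H x) ht0.le ht1.le)
        (cNormR 1 (H x) (blkSK x.toKIdx (sIK x.toKIdx (bI x))) hGeo.lenle 0) (W ν μ)
        (fun a a' => inputConst44 dE δ₀ α NI N' C L (BI t) (θI t) * Real.exp (-(ρE * (geo9K x.toKIdx).dist a a'))) := by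
    intro t ht0 ht1 ν μ
    have h := (hEng ν μ).1 t ht0 ht1.le
    rw [hbHXT x U] at h
    beta_reduce at h
    rw [bHZPIfam_of_mem x.toKIdx b _ ht0.le ht1.le, hblk x, h𝔡d x U ν, hGp x U, h𝔡s x U μ, ← hρEdef] at h
    exact hasMaj_cNormR_zero_of_ofBlocks hGeo.lenle h
  -- the direction slice between the print-exact classes at rate `ρE`, transferred at `αδ₀`
  have hSl : ∀ (t : ℝ) (ht0 : 0 < t) (ht1 : t < 1) (μ ν : Fin (d + 1)),
      HasMaj (bHZKPI (κ := κ) x.toKIdx b (taxiB x.toKIdx (bg x) (cfg x) U) (R := (1 : ℝ)) (H := H x) ht0.le ht1.le)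
        (bHZPI (κ := κ) x.toKIdx b (taxiS x.toKIdx (bg x) (cfg x) U) (R := (1 : ℝ)) (H := H x) ht0.le ht1.le) (dirSliceK x.toKIdx μ ν)
        (fun a a' => Cσ * Real.exp (-((ρE - α * δ₀) * (geo9K x.toKIdx).dist a a'))) := by
    intro t ht0 ht1 μ ν
    have h := hasMaj_dirSliceK_bHZKPI_bHZPI (κ := κ) x.toKIdx b (cfg x) U (R₀ := (1 : ℝ)) (H₀ := H x) (bI := bI x) hUn (hβ1 x) (hcf x)
      ht0 ht1 hρE0.le hσ₀0 hMtr' μ ν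
    rw [← hLdef, ← hCσ] at h
    exact h
  -- composition: the directional words from the print-exact bond class, rate `ρE − 2αδ₀`
  have hρ20 : 0 ≤ ρE - 2 * (α * δ₀) := by linarith only [hρE3, hσ₀0]
  have hK44nn : ∀ (t : ℝ), 0 < t → t < 1 → 0 ≤ inputConst44 dE δ₀ α NI N' C L (BI t) (θI t) := by
    intro t ht0 ht1
    have := hBI t ht0 ht1.le; have := hθI t ht0; unfold inputConst44; positivity
  have hSfam : ∀ (t : ℝ) (ht0 : 0 < t) (ht1 : t < 1) (dir ν μ : Fin (d + 1)),
      HasMaj (bHZKPI (κ := κ) x.toKIdx b (taxiB x.toKIdx (bg x) (cfg x) U) (R := (1 : ℝ)) (H := H x) ht0.le ht1.le)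
        (cNormR 1 (H x) (blkSK x.toKIdx (sIK x.toKIdx (bI x))) hGeo.lenle 0) (S dir ν μ)
        (fun a a' => (1 + CLip d ℓ) * inputConst44 dE δ₀ α NI N' C L (BI t) (θI t) * Cσ * B6.c1 dE δ₀ α *
          Real.exp (-((ρE - 2 * (α * δ₀)) * (geo9K x.toKIdx).dist a a'))) :=
    fun t ht0 ht1 dir ν μ => hasMaj_comp_exp
      htri (fun a a' => geo9K_dist_nonneg x.toKIdx a a') hrow (hK44nn t ht0 ht1) hCσ0 hρ20 (by linarith only [hσ₀0]) (by linarith only [hσ₀0]) (hE44 t ht0 ht1 dir μ) (hSl t ht0 ht1 μ ν)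
  -- (i) `h44G`: the bond read-off at the exponent `s`, then the source length returned to the target by (2.60)
  have hK44 : 0 ≤ (1 + CLip d ℓ) * inputConst44 dE δ₀ α NI N' C L (BI s) (θI s) * Cσ * B6.c1 dE δ₀ α :=
    mul_nonneg (mul_nonneg (mul_nonneg hκ₂0 (hK44nn s hs0 hs1)) hCσ0) hc₁0
  have hB2 := hasMaj_bond_of_dirSumFamily x.toKIdx hGeo (hbI0 x) S hT hK44 (hSfam s hs0 hs1)
  have hB2' : HasMaj (bHZKPI (κ := κ) x.toKIdx b (taxiB x.toKIdx (bg x) (cfg x) U) (R := (1 : ℝ)) (H := H x) hs0.le hs1.le)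
      (cNormR 1 (H x) (blkBK x.toKIdx (bI x)) hGeo.lenle 0)
      (DvcoKH x.toKIdx b (bg x) (cfg x) U ∘ₗ (GcoS x.toKIdx b (bg x) (cfg x) (O x) U ∘ₗ DvscoKH x.toKIdx b (bg x) (cfg x) U))
      (fun a a' => (((d + 1 : ℕ) : ℝ)) * ((1 + CLip d ℓ) * inputConst44 dE δ₀ α NI N' C L (BI s) (θI s) * Cσ * B6.c1 dE δ₀ α) *
        Real.exp (-((ρE - 2 * (α * δ₀)) * (geo9K x.toKIdx).dist a a'))) :=
    hB2.mono fun a a' => le_of_eq (by rw [hγ]; ring)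
  have h44 := hasMaj_bHZKP_of_bHZKPI (κ := κ) x.toKIdx b (taxiB x.toKIdx (bg x) (cfg x) U) (R := (1 : ℝ)) (H := H x) hs0.le hs1.le hGeo
    (mul_nonneg (by positivity) hK44) hTr hB2'
  rw [hr3, show ((0 : ℝ) - 1) = -((1 : ℕ) : ℝ) by norm_num] at h44
  refine ⟨?_, ?_⟩
  · subst hCσ
    intro y' A hA y
    have h := h44 y' A hA y
    rw [cNormR_loc_neg_natCast hGeo (blkBK x.toKIdx (bI x)) 1 y] at h
    exact h
  -- (ii) `hp45W` for every `β′ ∈ [0,1)`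
  intro β' h0 h1
  set t : ℝ := sch β' with htdef
  have htgt : β' < t := hschβ β' h0 h1
  have ht0 : 0 < t := h0.trans_lt htgt
  have ht1 : t < 1 := hsch1 β' h0 h1
  have hε0 : 0 < t - β' := by linarith only [htgt]
  have hε1 : t - β' ≤ 1 := by linarith only [ht1, h0]
  set hcβ : ℝ := holderConst dE δ₀ α NH N' C (Bl β') (BV β') with hhcβ
  have hhc0 : 0 ≤ hcβ := hhc β' h0 h1
  set K45 : ℝ := inputConst45 dE δ₀ α NI N' L hcβ (BI2 (t - β') β') (θI t) with hK45
  have hK450 : 0 ≤ K45 := by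
    have := hBI2 (t - β') β' hε0 hε1 h0 h1; have := hθI t ht0; rw [hK45]; unfold inputConst45; positivity
  -- the engine's (3.45) member at `(ε, β) = (t − β′, β′)`, at the pins, the target weight moved into `𝔠_P^{(β′)}`
  have hE45 : ∀ ν μ : Fin (d + 1),
      HasMaj (bHZPI (κ := κ) x.toKIdx b (taxiS x.toKIdx (bg x) (cfg x) U) (R := (1 : ℝ)) (H := H x) ht0.le ht1.le)
        (cNormR 1 (H x) (blkPK (sIK x.toKIdx (bI x))) hGeo.lenle β')
        ((holderProbesSN x.toKIdx b (bg x) (cfg x) (parSymY x.toKIdx) (bI x)).ΦX U β' ∘ₗ W ν μ)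
        (fun a a' => K45 * Real.exp (-(ρE * (geo9K x.toKIdx).dist a a'))) := by
    intro ν μ
    have h := (hEng ν μ).2 (t - β') β' hε0 hε1 h0 h1
    have hsum : β' + (t - β') = t := by ring
    rw [hsum, hbHXT x U] at h
    beta_reduce at h
    rw [bHZPIfam_of_mem x.toKIdx b _ ht0.le ht1.le, h𝔭 x, blkPX_SN, h𝔡d x U ν, hGp x U, h𝔡s x U μ, ← hρEdef] at h
    exact hasMaj_cNormR_of_target_rpow hGeo (C := fun _ _ => K45) (E := fun a a' => Real.exp (-(ρE * (geo9K x.toKIdx).dist a a'))) (t := β') h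
  -- composition with the slice at the exponent `t`: the probe member from the print-exact bond class
  have hPfam : ∀ dir ν μ : Fin (d + 1),
      HasMaj (bHZKPI (κ := κ) x.toKIdx b (taxiB x.toKIdx (bg x) (cfg x) U) (R := (1 : ℝ)) (H := H x) ht0.le ht1.le)
        (cNormR 1 (H x) (blkPK (sIK x.toKIdx (bI x))) hGeo.lenle β')
        ((holderProbesSN x.toKIdx b (bg x) (cfg x) (parSymY x.toKIdx) (bI x)).ΦX U β' ∘ₗ S dir ν μ)
        (fun a a' => (1 + CLip d ℓ) * K45 * Cσ * B6.c1 dE δ₀ α * Real.exp (-((ρE - 2 * (α * δ₀)) * (geo9K x.toKIdx).dist a a'))) := by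
    intro dir ν μ
    have h := hasMaj_comp_exp
      htri (fun a a' => geo9K_dist_nonneg x.toKIdx a a') hrow hK450 hCσ0 hρ20 (by linarith only [hσ₀0]) (by linarith only [hσ₀0]) (hE45 dir μ) (hSl t ht0 ht1 μ ν)
    rw [LinearMap.comp_assoc] at h
    exact h
  -- un-weighting by (2.60): the sup and probe members from the print-weighted class `bHZKP (taxiB U) t`, rate `ρE − 3αδ₀`
  have hKSt : 0 ≤ (1 + CLip d ℓ) * inputConst44 dE δ₀ α NI N' C L (BI t) (θI t) * Cσ * B6.c1 dE δ₀ α :=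
    mul_nonneg (mul_nonneg (mul_nonneg hκ₂0 (hK44nn t ht0 ht1)) hCσ0) hc₁0
  have hKPt : 0 ≤ (1 + CLip d ℓ) * K45 * Cσ * B6.c1 dE δ₀ α := mul_nonneg (mul_nonneg (mul_nonneg hκ₂0 hK450) hCσ0) hc₁0
  have hsupT : ∀ dir ν μ : Fin (d + 1),
      HasMaj (bHZKP (κ := κ) x.toKIdx b (taxiB x.toKIdx (bg x) (cfg x) U) (R := (1 : ℝ)) (H := H x) ht0.le ht1.le)
        (cNormR 1 (H x) (blkSK x.toKIdx (sIK x.toKIdx (bI x))) hGeo.lenle (-1)) (S dir ν μ)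
        (fun a a' => L * ((1 + CLip d ℓ) * inputConst44 dE δ₀ α NI N' C L (BI t) (θI t) * Cσ * B6.c1 dE δ₀ α) *
          Real.exp (-((ρE - 3 * (α * δ₀)) * (geo9K x.toKIdx).dist a a'))) := by
    intro dir ν μ
    have h := hasMaj_bHZKP_of_bHZKPI (κ := κ) x.toKIdx b (taxiB x.toKIdx (bg x) (cfg x) U) (R := (1 : ℝ)) (H := H x) ht0.le ht1.le hGeo
      hKSt hTr (hSfam t ht0 ht1 dir ν μ)
    rw [zero_sub, hr3] at h
    exact h
  have hprT : ∀ dir ν μ : Fin (d + 1),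
      HasMaj (bHZKP (κ := κ) x.toKIdx b (taxiB x.toKIdx (bg x) (cfg x) U) (R := (1 : ℝ)) (H := H x) ht0.le ht1.le)
        (cNormR 1 (H x) (blkPK (sIK x.toKIdx (bI x))) hGeo.lenle (β' - 1))
        ((holderProbesSN x.toKIdx b (bg x) (cfg x) (parSymY x.toKIdx) (bI x)).ΦX U β' ∘ₗ S dir ν μ)
        (fun a a' => L * ((1 + CLip d ℓ) * K45 * Cσ * B6.c1 dE δ₀ α) * Real.exp (-((ρE - 3 * (α * δ₀)) * (geo9K x.toKIdx).dist a a'))) := by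
    intro dir ν μ
    have h := hasMaj_bHZKP_of_bHZKPI (κ := κ) x.toKIdx b (taxiB x.toKIdx (bg x) (cfg x) U) (R := (1 : ℝ)) (H := H x) ht0.le ht1.le hGeo
      hKPt hTr (hPfam dir ν μ)
    rw [hr3] at h
    exact h
  -- the transporter change `parSymY → parSY` of the near probes (print's (3.35)), then the bond-probe read-off
  have hρ30 : 0 ≤ ρE - 3 * (α * δ₀) := by linarith only [hρE3]
  have hβ2 : β' ≤ 2 := by linarith only [h1]
  have hC₀0 : 0 ≤ L * ((1 + CLip d ℓ) * inputConst44 dE δ₀ α NI N' C L (BI t) (θI t) * Cσ * B6.c1 dE δ₀ α) := mul_nonneg hL0 hKSt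
  have hCb0 : 0 ≤ L * ((1 + CLip d ℓ) * K45 * Cσ * B6.c1 dE δ₀ α) := mul_nonneg hL0 hKPt
  have htrP := fun dir ν μ : Fin (d + 1) => hasMaj_probesSN_parSY_of_parSymY x.toKIdx b hGeo (cfg x) U hc10 hMα hreg hG1 (hlev x) (hβ1 x) (hcf x) h0 hβ2
    hC₀0 hCb0 hρ30 (hsupT dir ν μ) (hprT dir ν μ)
  have hLk1 : (1 : ℝ) ≤ (kGeo x.toKIdx).L := B9Eq335PlaquetteAtLettersY.one_le_L x.toKIdx
  have hLk0 : (0 : ℝ) ≤ (kGeo x.toKIdx).L := zero_le_one.trans hLk1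
  have hfac : 0 ≤ 2 * coordBound39 b * basisBound39 b * ((ℓ : ℝ) + 1) * Real.exp ((ρE - 3 * (α * δ₀)) * (((d : ℝ) + 1) * (((ℓ : ℝ) + 1) + 1) + 2)) := by positivity
  have hmidM0 : 0 ≤ (((d + 1 : ℕ) : ℝ)) ^ 2 * (2 * (10 * (kGeo x.toKIdx).L * ((kGeo x.toKIdx).M * α₀)) * (1 + 10 * (kGeo x.toKIdx).L * ((kGeo x.toKIdx).M * α₀)) *
      Real.exp (4 * (10 * (kGeo x.toKIdx).L * ((kGeo x.toKIdx).M * α₀)))) * (kGeo x.toKIdx).L ^ 6 := by positivity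
  have hCb1 : 0 ≤ L * ((1 + CLip d ℓ) * K45 * Cσ * B6.c1 dE δ₀ α) + 2 * coordBound39 b * basisBound39 b * ((ℓ : ℝ) + 1) *
        Real.exp ((ρE - 3 * (α * δ₀)) * (((d : ℝ) + 1) * (((ℓ : ℝ) + 1) + 1) + 2)) *
        ((((d + 1 : ℕ) : ℝ)) ^ 2 * (2 * (10 * (kGeo x.toKIdx).L * ((kGeo x.toKIdx).M * α₀)) * (1 + 10 * (kGeo x.toKIdx).L * ((kGeo x.toKIdx).M * α₀)) *
          Real.exp (4 * (10 * (kGeo x.toKIdx).L * ((kGeo x.toKIdx).M * α₀)))) * (kGeo x.toKIdx).L ^ 6) *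
          (L * ((1 + CLip d ℓ) * inputConst44 dE δ₀ α NI N' C L (BI t) (θI t) * Cσ * B6.c1 dE δ₀ α)) +
        coordBound39 b * basisBound39 b * (L * ((1 + CLip d ℓ) * inputConst44 dE δ₀ α NI N' C L (BI t) (θI t) * Cσ * B6.c1 dE δ₀ α)) +
        L * ((1 + CLip d ℓ) * inputConst44 dE δ₀ α NI N' C L (BI t) (θI t) * Cσ * B6.c1 dE δ₀ α) :=
    add_nonneg (add_nonneg (add_nonneg hCb0 (mul_nonneg (mul_nonneg hfac hmidM0) hC₀0)) (mul_nonneg (mul_nonneg hcb hbb) hC₀0)) hC₀0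
  have hKA := hasMaj_probesKA_of_dirSumFamily x.toKIdx b (cfg x) U hGeo hUn (hlev x) (hbI0 x) (hcf x) S hT hC₀0 hCb1 hsupT htrP
  -- `K_pl(10·L·Mα₀) ≤ K_pl(10·L·a₁∕c)`: the member-independent constant
  have hLk : (kGeo x.toKIdx).L = L := by rw [hLdef]
  have hK : 10 * L * ((kGeo x.toKIdx).M * α₀) ≤ 10 * L * (a₁ / c35) := mul_le_mul_of_nonneg_left hMa₁ (by positivity)
  have hpl := B9Eq335CoveragePAtLettersY.plaqBound_mono (C := 10 * L * ((kGeo x.toKIdx).M * α₀)) (C' := 10 * L * (a₁ / c35)) (by positivity) hK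
  have hmid : (((d + 1 : ℕ) : ℝ)) ^ 2 * (2 * (10 * (kGeo x.toKIdx).L * ((kGeo x.toKIdx).M * α₀)) * (1 + 10 * (kGeo x.toKIdx).L * ((kGeo x.toKIdx).M * α₀)) *
        Real.exp (4 * (10 * (kGeo x.toKIdx).L * ((kGeo x.toKIdx).M * α₀)))) * (kGeo x.toKIdx).L ^ 6 ≤
      (((d + 1 : ℕ) : ℝ)) ^ 2 * (2 * (10 * L * (a₁ / c35)) * (1 + 10 * L * (a₁ / c35)) * Real.exp (4 * (10 * L * (a₁ / c35)))) * L ^ 6 := by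
    rw [hLk]
    exact mul_le_mul_of_nonneg_right (mul_le_mul_of_nonneg_left hpl (by positivity)) (by positivity)
  have hmain := mul_le_mul_of_nonneg_right (mul_le_mul_of_nonneg_left hmid hfac) hC₀0
  subst hCσ
  refine hKA.mono fun a a' => ?_
  rw [hγ, mul_one]
  refine mul_le_mul_of_nonneg_right ?_ (Real.exp_nonneg _)
  refine mul_le_mul_of_nonneg_left ?_ (by positivity)
  linarith only [hmain]

end Literature.MathematicalPhysics.QuantumFieldTheory.Balaban1983to89.B9H44GFromPinsSN

end
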